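import Summits.KontsevichZagierPeriods.KontsevichZagierPeriods.Theses.LinRedNormalForm

/-!
# KontsevichZagierPeriods / LinRedNormalForm — the glue `ArrangementSectorGlue` (stmt-KontsevichZagierPeriods-14839)

Route `KontsevichZagierPeriods/LinRedNormalForm`, support item stmt-KontsevichZagierPeriods-14839
(`ArrangementSectorGlue`):

  `ArrangementNormalForm → HyperlogKernelInKZ → GenusZeroValuesMzv → DihedralNormalForm`.

Informal content.  The dihedral (genus-zero) normal form splits into an ANALYTIC half and an
ARITHMETIC half.  Let `r` be a genus-zero representation: its domain is the open ordered simplex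
`{1 > t₀ > … > t_{k−1} > 0}` and its integrand is `P(t)/(∏ tᵢ^{bᵢ} ∏ (1−tᵢ)^{cᵢ} ∏_{i<j} (tᵢ−tⱼ)^{aᵢⱼ})`.
(i) MATCHING.  The simplex IS the open rational polyhedral cell cut out by the affine forms `tᵢ`,
`1 − tᵢ`, `tᵢ − tⱼ (i < j)`, and the denominator IS `∏ⱼ Lⱼ^{eⱼ}` for the affine forms `tᵢ`, `1 − tᵢ`,
`tᵢ − tⱼ` with exponents `bᵢ`, `cᵢ`, `[i<j]·aᵢⱼ` (rows indexed by a finite sum type and transported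
to `Fin _` along `Fintype.equivFin`).  Hence `ArrangementNormalForm` applies and gives `h` in the
closure of the hyperlogarithm word representations with `[r] − h ∈ KZ.relations`.
(ii) `GenusZeroValuesMzv` (Brown's theorem, typed) gives `m` in the closure of the MZV word
representations with `eval m = r.value`.
(iii) Every MZV word representation is a hyperlogarithm word representation (letters `aᵢ = [εᵢ]`,
`1/(1−t) = (−1)·1/(t−1)`, the sign absorbed into the rational constant), so `h − m` lies in the
closure of the hyperlogarithm word representations, and `eval (h − m) = r.value − r.value = 0` by
soundness of the calculus (`KZ.relations_le_ker_eval_holds`).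
(iv) `HyperlogKernelInKZ` gives `h − m ∈ KZ.relations`, whence `[r] − m = ([r] − h) + (h − m) ∈
KZ.relations`, which is `DihedralNormalForm` for `r`.

The three antecedents are items of the route and are NOT discharged here: the theorem is the
implication, nothing more.

References: M. Kontsevich, D. Zagier, *Periods* (2001), §1.2 (the rules; soundness);
F. Brown, *Multiple zeta values and periods of moduli spaces `𝔐_{0,n}`*, Ann. Sci. ÉNS 42 (2009),
Thm 1.1.
-/

namespace Summit.KontsevichZagierPeriods.LinRedNormalForm

open Literature.NumberTheory.Transcendental

/-- A rational row supported on one coordinate evaluates to that coordinate (scaled):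
`∑ᵢ' (single i c)ᵢ' · xᵢ' = c · xᵢ`. [folklore] -/
theorem arrangementSectorGlue_row_single {k : ℕ} (i : Fin k) (c : ℚ) (x : Fin k → ℝ) :
    ∑ i', ((Pi.single i c : Fin k → ℚ) i' : ℝ) * x i' = (c : ℝ) * x i := by
  rw [Finset.sum_eq_single i]
  · rw [Pi.single_eq_same]
  · intro j _ hj
    rw [Pi.single_eq_of_ne hj, Rat.cast_zero, zero_mul]
  · intro h
    exact absurd (Finset.mem_univ i) h

/-- The difference row `eᵢ − eⱼ` evaluates to `xᵢ − xⱼ`. [folklore] -/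
theorem arrangementSectorGlue_row_sub {k : ℕ} (i j : Fin k) (x : Fin k → ℝ) :
    ∑ i', ((Pi.single i 1 - Pi.single j 1 : Fin k → ℚ) i' : ℝ) * x i' = x i - x j := by
  simp only [Pi.sub_apply, Rat.cast_sub, sub_mul, Finset.sum_sub_distrib,
    arrangementSectorGlue_row_single, Rat.cast_one, one_mul]

/-- Transport of a finite family of rational affine rows along an enumeration `ι ≃ Fin m'`: a set
described by positivity of rows indexed by `ι` is a rational polyhedral cell with rows indexed by
`Fin m'`. [folklore] -/
theorem arrangementSectorGlue_cell_transport {k m' : ℕ} {ι : Type*} (E : ι ≃ Fin m')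
    (M' : ι → (Fin k → ℚ) × ℚ) (S : Set (Fin k → ℝ))
    (hS : ∀ x, x ∈ S ↔ ∀ y, 0 < ∑ i, ((M' y).1 i : ℝ) * x i + ((M' y).2 : ℝ)) :
    ∃ M : Fin m' → (Fin k → ℚ) × ℚ,
      S = {x | ∀ j, 0 < ∑ i, ((M j).1 i : ℝ) * x i + ((M j).2 : ℝ)} :=
  ⟨fun j => M' (E.symm j), by
    ext x
    rw [Set.mem_setOf_eq, hS x]
    exact E.forall_congr_left⟩

/-- Transport of a finite family of powers of rational affine forms along an enumeration
`ι ≃ Fin m`. [folklore] -/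
theorem arrangementSectorGlue_prod_transport {k m : ℕ} {ι : Type*} [Fintype ι] (E : ι ≃ Fin m)
    (L' : ι → (Fin k → ℚ) × ℚ) (e' : ι → ℕ) (F : (Fin k → ℝ) → ℝ)
    (hF : ∀ t, F t = ∏ y, (∑ i, ((L' y).1 i : ℝ) * t i + ((L' y).2 : ℝ)) ^ e' y) :
    ∃ (L : Fin m → (Fin k → ℚ) × ℚ) (e : Fin m → ℕ),
      ∀ t, F t = ∏ j, (∑ i, ((L j).1 i : ℝ) * t i + ((L j).2 : ℝ)) ^ e j :=
  ⟨fun j => L' (E.symm j), fun j => e' (E.symm j), fun t => by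
    rw [hF t]
    exact (Equiv.prod_comp E.symm
      (fun y => (∑ i, ((L' y).1 i : ℝ) * t i + ((L' y).2 : ℝ)) ^ e' y)).symm⟩

/-- MATCHING, domain side: the open ordered simplex `{1 > t₀ > … > t_{k−1} > 0}` is the open
rational polyhedral cell of the braid arrangement, cut out by the rows `tᵢ > 0`, `1 − tᵢ > 0` and
`tᵢ − tⱼ > 0 (i < j)`. [folklore] -/
theorem arrangementSectorGlue_simplex_eq_cell (k : ℕ) :
    ∃ (m' : ℕ) (M : Fin m' → (Fin k → ℚ) × ℚ),
      ({t | (∀ i, 0 < t i) ∧ (∀ i, t i < 1) ∧ StrictAnti t} : Set (Fin k → ℝ)) =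
        {x | ∀ j, 0 < ∑ i, ((M j).1 i : ℝ) * x i + ((M j).2 : ℝ)} := by
  refine ⟨_, arrangementSectorGlue_cell_transport
    (Fintype.equivFin ((Fin k ⊕ Fin k) ⊕ {p : Fin k × Fin k // p.1 < p.2}))
    (Sum.elim
      (Sum.elim (fun i => ((Pi.single i 1 : Fin k → ℚ), (0 : ℚ)))
        (fun i => ((Pi.single i (-1) : Fin k → ℚ), (1 : ℚ))))
      (fun p => ((Pi.single p.1.1 1 - Pi.single p.1.2 1 : Fin k → ℚ), (0 : ℚ))))
    _ (fun x => ?_)⟩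
  simp only [Set.mem_setOf_eq, Sum.forall, Subtype.forall, Prod.forall, Sum.elim_inl,
    Sum.elim_inr, arrangementSectorGlue_row_single, arrangementSectorGlue_row_sub, Rat.cast_zero,
    Rat.cast_one, Rat.cast_neg, add_zero, one_mul, neg_mul, neg_add_eq_sub, sub_pos]
  exact ⟨fun ⟨h0, h1, h2⟩ => ⟨⟨h0, h1⟩, fun i j hij => h2 hij⟩,
    fun ⟨⟨h0, h1⟩, h2⟩ => ⟨h0, h1, fun i j hij => h2 i j hij⟩⟩

/-- MATCHING, integrand side: the genus-zero denominator
`∏ tᵢ^{bᵢ} ∏ (1−tᵢ)^{cᵢ} ∏_{i<j} (tᵢ−tⱼ)^{aᵢⱼ}` is a product of powers of rational affine forms (the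
forms `tᵢ`, `1 − tᵢ`, `tᵢ − tⱼ` with exponents `bᵢ`, `cᵢ`, `[i<j]·aᵢⱼ`). [folklore] -/
theorem arrangementSectorGlue_braid_eq_prod (k : ℕ) (a : Fin k → Fin k → ℕ) (b c : Fin k → ℕ) :
    ∃ (m : ℕ) (L : Fin m → (Fin k → ℚ) × ℚ) (e : Fin m → ℕ), ∀ t : Fin k → ℝ,
      (∏ i, t i ^ b i) * (∏ i, (1 - t i) ^ c i) *
          (∏ i, ∏ j, if i < j then (t i - t j) ^ a i j else 1) =
        ∏ j, (∑ i, ((L j).1 i : ℝ) * t i + ((L j).2 : ℝ)) ^ e j := by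
  refine ⟨_, arrangementSectorGlue_prod_transport
    (Fintype.equivFin ((Fin k ⊕ Fin k) ⊕ (Fin k × Fin k)))
    (Sum.elim
      (Sum.elim (fun i => ((Pi.single i 1 : Fin k → ℚ), (0 : ℚ)))
        (fun i => ((Pi.single i (-1) : Fin k → ℚ), (1 : ℚ))))
      (fun p => ((Pi.single p.1 1 - Pi.single p.2 1 : Fin k → ℚ), (0 : ℚ))))
    (Sum.elim (Sum.elim b c) (fun p => if p.1 < p.2 then a p.1 p.2 else 0))
    _ (fun t => ?_)⟩
  simp only [Fintype.prod_sum_type, Fintype.prod_prod_type, Sum.elim_inl, Sum.elim_inr,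
    arrangementSectorGlue_row_single, arrangementSectorGlue_row_sub, Rat.cast_zero, Rat.cast_one,
    Rat.cast_neg, add_zero, one_mul, neg_mul, neg_add_eq_sub, pow_ite, pow_zero]

/-- The two letters of MZV words are hyperlogarithm letters: `ω₀(x) = 1/x = 1/(x − 0)` and
`ω₁(x) = 1/(1 − x) = (−1)·1/(x − 1)`. [folklore] -/
theorem arrangementSectorGlue_letter (b : Bool) (x : ℝ) :
    (if b then 1 / (1 - x) else 1 / x) =
      ((if b then (-1 : ℚ) else 1 : ℚ) : ℝ) * (1 / (x - ((if b then (1 : ℚ) else 0 : ℚ) : ℝ))) := by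
  cases b
  · simp
  · simp only [if_true, Rat.cast_neg, Rat.cast_one, neg_one_mul]
    rw [← neg_sub x 1, div_neg]

/-- Every MZV word representation `[Δ_w, q·∏ ω_{εᵢ}(tᵢ)]` is a hyperlogarithm word representation
`[Δ_w, q'·∏ (tᵢ − aᵢ)⁻¹]` with rational letters `aᵢ = [εᵢ] ∈ {0, 1}` and `q' = q·∏ (εᵢ ? −1 : 1)`.
[folklore] -/
theorem arrangementSectorGlue_mzvWords_subset_hyperlogWords :
    {x : KZ.FormalRep | ∃ (w : ℕ) (ε : Fin w → Bool) (q : ℚ) (s : KZ.IntegralRep w),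
        s.domain = {t | (∀ i, 0 < t i) ∧ (∀ i, t i < 1) ∧ StrictAnti t} ∧
        Set.EqOn s.integrand (fun t => (q : ℝ) * ∏ i, if ε i then 1 / (1 - t i) else 1 / t i)
          s.domain ∧ x = KZ.of s} ⊆
    {y : KZ.FormalRep | ∃ (w : ℕ) (a : Fin w → ℚ) (q : ℚ) (s : KZ.IntegralRep w),
        s.domain = {t | (∀ i, 0 < t i) ∧ (∀ i, t i < 1) ∧ StrictAnti t} ∧
        Set.EqOn s.integrand (fun t => (q : ℝ) * ∏ i, 1 / (t i - (a i : ℝ))) s.domain ∧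
        y = KZ.of s} := by
  rintro x ⟨w, ε, q, s, hdom, hint, rfl⟩
  refine ⟨w, fun i => if ε i then 1 else 0, q * ∏ i, (if ε i then -1 else 1), s, hdom, ?_, rfl⟩
  intro t ht
  rw [hint ht]
  dsimp only
  rw [Rat.cast_mul, Rat.cast_prod, mul_assoc, ← Finset.prod_mul_distrib]
  congr 1
  exact Finset.prod_congr rfl fun i _ => arrangementSectorGlue_letter (ε i) (t i)

/-- **Arrangement-sector glue of route LinRedNormalForm** (settles stmt-KontsevichZagierPeriods-14839):
`ArrangementNormalForm → HyperlogKernelInKZ → GenusZeroValuesMzv → DihedralNormalForm`.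
Given a genus-zero representation `r`, (i) the simplex is the open rational polyhedral cell of the
braid arrangement and the integrand is `P/∏ⱼ Lⱼ^{eⱼ}` for the affine forms `tᵢ`, `1 − tᵢ`, `tᵢ − tⱼ`
(`arrangementSectorGlue_simplex_eq_cell`, `arrangementSectorGlue_braid_eq_prod`), so the
arrangement normal form gives `h` in the closure of the hyperlogarithm word representations with
`[r] − h ∈ KZ.relations`; (ii) Brown's theorem gives `m` in the closure of the MZV word
representations with `eval m = r.value`; (iii) MZV words are hyperlogarithm words
(`arrangementSectorGlue_mzvWords_subset_hyperlogWords`, `AddSubgroup.closure_mono`) and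
`eval (h − m) = 0` by soundness `KZ.relations_le_ker_eval_holds`; (iv) the hyperlogarithm kernel
gives `h − m ∈ KZ.relations`, so `[r] − m = ([r] − h) + (h − m) ∈ KZ.relations`.
[Kontsevich–Zagier 2001, §1.2; Brown 2009, Thm 1.1] [folklore] -/
theorem arrangementSectorGlue_proof :
    Summit.KontsevichZagierPeriods.KontsevichZagierPeriods.Theses.LinRedNormalForm.ArrangementSectorGlue := by
  unfold Summit.KontsevichZagierPeriods.KontsevichZagierPeriods.Theses.LinRedNormalForm.ArrangementSectorGlue
  intro hANF hKER hVAL k r p a b c hdom hint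
  -- (i) matching: the simplex is a rational polyhedral cell and the braid denominator a product of
  -- powers of rational affine forms, so the arrangement normal form applies to `r`
  obtain ⟨m', M, hM⟩ := arrangementSectorGlue_simplex_eq_cell k
  obtain ⟨m, L, e, hL⟩ := arrangementSectorGlue_braid_eq_prod k a b c
  have hint' : Set.EqOn r.integrand
      (fun x => MvPolynomial.aeval x p / ∏ j, (∑ i, ((L j).1 i : ℝ) * x i + ((L j).2 : ℝ)) ^ e j)
      r.domain := fun x hx => by
    rw [hint hx]
    dsimp only
    rw [hL x]
  obtain ⟨h, hh, hrh⟩ := hANF k m m' r M L e p (hdom.trans hM) hint'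
  -- (ii) Brown's theorem: the value of `r` is that of a ℤ-combination of MZV word representations
  obtain ⟨mm, hmm, hval⟩ := hVAL k r p a b c hdom hint
  -- (iii) soundness of the calculus: relations evaluate to zero, so `eval h = r.value = eval mm`
  have hsound : ∀ x ∈ KZ.relations, KZ.eval x = 0 := fun x hx =>
    (AddMonoidHom.mem_ker).1 (KZ.relations_le_ker_eval_holds hx)
  have h₁ := hsound _ hrh
  rw [map_sub, KZ.eval_of] at h₁
  -- (iv) MZV words are hyperlogarithm words, and the hyperlogarithm kernel makes `h - mm` a relation
  have hker : h - mm ∈ KZ.relations :=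
    hKER (h - mm)
      (sub_mem hh
        (AddSubgroup.closure_mono arrangementSectorGlue_mzvWords_subset_hyperlogWords hmm))
      (by rw [map_sub, hval]; linarith)
  refine ⟨mm, hmm, ?_⟩
  have key := add_mem hrh hker
  rwa [sub_add_sub_cancel] at key

end Summit.KontsevichZagierPeriods.LinRedNormalForm
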